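import Mathlib

/-!
# Route `FilamentSkeletonRss` · crux `TransverseReductionRJ` (stmt-NavierStokesRegularity-21221) — line `kelvin_gate`,
# stub S3 `NonlinearClosing` (fed by stub S2's TIGHT + locally continuous gate): the LADDER LEMMA behind the continuity of
# the multipliers `p ↦ B_p`

Helper file (theorems only, `--supports stmt-NavierStokesRegularity-21221 --as helper`); pure real analysis, no route
vocabulary.  HONEST FRAMING: bookkeeping for a HYPOTHETICAL filament-type RSS blow-up route; nothing here bears on
Navier–Stokes regularity; no stub is proved here.

The line card singles out ONE non-routine step in stub S3: continuity in the box parameter `p` of the fixed point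
`W_p = 𝓚_p(−r_p − DW_p[W_p])` in the LOCAL topology, obtained from (i) the uniform contraction (rate `θ < 1`), (ii) the
gate's TIGHTNESS and (iii) its LOCAL continuity in `p` (clauses (3), (4) of `GateSpec`, stub S2): "iterate
`a_L ≤ ε(L, L′) + θ a_{L′}` down a ladder of radii; `a_{L′}` is uniformly bounded".  This file proves exactly that
iteration, abstractly:

* `ladder_bound` — if `a L q ≤ e L q + θ · a (L′ L) q` for all rungs `L` and `0 ≤ θ`, then for every `n`,
  `a L q ≤ Σ_{i<n} θ^i · e (L′^[i] L) q + θ^n · a (L′^[n] L) q`;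
* `ladder_tendsto_zero` — if moreover `0 ≤ a ≤ M` uniformly, `θ < 1`, and every error term `e L` tends to `0` as
  `q → p`, then every `a L` tends to `0` as `q → p`.
In S3: `a L q = sup_{B_L} (|W_q − W_p| + |DW_q − DW_p|)`, `e L q` = (local continuity of `𝓚` and of `r` on a larger
ball `B_{L′(L)}`) + (tightness error), `θ = ½` from the contraction, `M` = twice the X-radius of the fixed-point ball.
-/

set_option linter.dupNamespace false

noncomputable section

namespace Summit.NavierStokesRegularity.NavierStokesRegularity.Theorems.KelvinGate

open Filter Topology Finset

/-- **Ladder bound.**  From the one-step inequality `a L q ≤ e L q + θ a (L′ L) q` (`θ ≥ 0`) on every rung,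
`a L q ≤ Σ_{i<n} θ^i e (L′^[i] L) q + θ^n a (L′^[n] L) q` for every `n`. -/
theorem ladder_bound {ι P : Type*} (L' : ι → ι) (a e : ι → P → ℝ) {θ : ℝ} (hθ0 : 0 ≤ θ)
    (hstep : ∀ L q, a L q ≤ e L q + θ * a (L' L) q) (q : P) :
    ∀ (n : ℕ) (L : ι), a L q ≤ (∑ i ∈ range n, θ ^ i * e (L'^[i] L) q) + θ ^ n * a (L'^[n] L) q := by
  intro n
  induction n with
  | zero => intro L; simp
  | succ n ih =>
    intro L
    have h1 := ih L
    have h2 := hstep (L'^[n] L) q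
    have h3 : θ ^ n * a (L'^[n] L) q ≤ θ ^ n * (e (L'^[n] L) q + θ * a (L' (L'^[n] L)) q) :=
      mul_le_mul_of_nonneg_left h2 (pow_nonneg hθ0 n)
    rw [sum_range_succ, pow_succ]
    have e1 : L' (L'^[n] L) = L'^[n + 1] L := (Function.iterate_succ_apply' L' n L).symm
    rw [e1] at h3
    nlinarith [h1, h3]

/-- **Ladder lemma (continuity from contraction + tightness + local continuity).**  Let `a, e : ι → P → ℝ` with
`0 ≤ a L q ≤ M` for all rungs `L` and parameters `q`, `a L q ≤ e L q + θ a (L′ L) q` with `0 ≤ θ < 1`, and suppose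
every error term tends to zero at `p`: `e L q → 0` as `q → p`.  Then `a L q → 0` as `q → p`, for every rung `L`. -/
theorem ladder_tendsto_zero {ι P : Type*} [TopologicalSpace P] (L' : ι → ι) (a e : ι → P → ℝ) {θ M : ℝ} (p : P)
    (hθ0 : 0 ≤ θ) (hθ1 : θ < 1) (ha0 : ∀ L q, 0 ≤ a L q) (haM : ∀ L q, a L q ≤ M)
    (hstep : ∀ L q, a L q ≤ e L q + θ * a (L' L) q) (he : ∀ L, Tendsto (e L) (𝓝 p) (𝓝 0)) (L : ι) :
    Tendsto (a L) (𝓝 p) (𝓝 0) := by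
  rw [Metric.tendsto_nhds]
  intro ε hε
  -- choose the depth of the ladder: `θ^n M < ε/2`
  have hM0 : 0 ≤ M := (ha0 L p).trans (haM L p)
  obtain ⟨n, hn⟩ : ∃ n : ℕ, θ ^ n * M < ε / 2 := by
    have ht : Tendsto (fun n : ℕ => θ ^ n * M) atTop (𝓝 (0 * M)) :=
      (tendsto_pow_atTop_nhds_zero_of_lt_one hθ0 hθ1).mul_const M
    rw [zero_mul] at ht
    exact ((ht.eventually (gt_mem_nhds (by linarith : (0:ℝ) < ε / 2))).exists)
  -- the finite error sum tends to zero
  have hsum : Tendsto (fun q => ∑ i ∈ range n, θ ^ i * e (L'^[i] L) q) (𝓝 p) (𝓝 0) := by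
    have : Tendsto (fun q => ∑ i ∈ range n, θ ^ i * e (L'^[i] L) q) (𝓝 p)
        (𝓝 (∑ i ∈ range n, θ ^ i * (0:ℝ))) :=
      tendsto_finsetSum _ fun i _ => (he (L'^[i] L)).const_mul (θ ^ i)
    simpa using this
  have hev := (Metric.tendsto_nhds.mp hsum) (ε / 2) (by linarith)
  filter_upwards [hev] with q hq
  have hq' : ∑ i ∈ range n, θ ^ i * e (L'^[i] L) q < ε / 2 := by
    rw [Real.dist_eq, sub_zero] at hq
    exact lt_of_abs_lt hq
  have hb := ladder_bound L' a e hθ0 hstep q n L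
  have htail : θ ^ n * a (L'^[n] L) q ≤ θ ^ n * M := mul_le_mul_of_nonneg_left (haM _ q) (pow_nonneg hθ0 n)
  rw [Real.dist_eq, sub_zero, abs_of_nonneg (ha0 L q)]
  linarith

end Summit.NavierStokesRegularity.NavierStokesRegularity.Theorems.KelvinGate
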